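import Literature.Computability.Complexity.QBFUniversalInstance
import HarnessLib

/-!
# Tseitin with PRE-ORDER gate numbering (the form a left-to-right scan of a prefix code emits), and
# every closed prenex QBF as an instance of Trevisan–Vadhan's universal formula through it

Literature / complexity — first file of the `PSPACE`-hardness of Trevisan–Vadhan's language `LTV`
(`TVFunction.lean`; TV07 Thm. 4.3 via Lemma 4.1 (ii): "`f_{n,0}` is `PSPACE`-hard"). The tree's Tseitin
transformation (`TseitinQBF.lean`) numbers the auxiliary gate variables in POST-order, which a
polynomial-time emitter reading the PREFIX code of a formula (`PropForm.code`, `CNF.lean`) cannot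
produce without a stack; here the same gate clauses (Arora–Barak 2009, Lemma 6.11) are allocated in
PRE-order — the node read at position `k` of the prefix code gets the variable `a + k`, its left child
`a + k + 1`, its right child `a + k + 1 + size(left)` — and emitted in pre-order, so that the emitter of
the sequel only needs the end of one sub-formula per node:

* `PreTseitin.gcl φ p` (the gate clauses of `φ` rooted at variable `p`), `cnfP φ a = gcl φ a ++ [(a)]`;
  `length_gcl_le`, `gcl_vars_lt`;
* `PreTseitin.val` (the intended gate values), `eval_gcl_val` (they satisfy the clauses),
  `root_eq_of_eval_gcl` (any satisfying assignment has the right root), **`eval_iff_exists`**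
  (Tseitin's equivalence);
* `PreTseitin.preQBF ψ` (auxiliaries quantified `∃` innermost), `isClosed_preQBF`,
  **`isTrue_preQBF_iff`**, and with `QBFUniversalInstance.lean`
  **`PreTseitin.isTrue_iff_holdsFrom_pre`**: a closed prenex QBF `ψ` is true iff Trevisan–Vadhan's
  universal formula of size `QBFUniv.sizeOf ψ` holds at the instance described by its pre-order
  Tseitin form.

Everything is proved; no named fact is introduced (D-0026).

## References

* G. S. Tseitin, *On the complexity of derivation in propositional calculus* (1968) [Tseitin1968].
* S. Arora, B. Barak, CUP 2009, Lemma 6.11 (proof), Thm. 4.13 [AroraBarakCC2009].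
* L. Trevisan, S. Vadhan, Comput. Complexity 16 (2007), §4, Lemma 4.1 (ii) [TrevisanVadhan2007].
-/

namespace Literature.Computability.Complexity

namespace PreTseitin

open Literature.Barriers.QuantumAdvantage Literature.Barriers.QuantumAdvantage.TQBFRed Tseitin QBFUniv

/-! ### The gate clauses in pre-order -/

/-- **The gate clauses of `φ` with pre-order auxiliaries from `p`**: the root of `φ` is `p`, the root
of its first sub-formula `p + 1`, of its second `p + 1 + size(first)`; gate encodings as in
`Tseitin.gatesAux`. [cite: AroraBarakCC2009, Lemma 6.11 (proof)] -/
def gcl : PropForm ℕ → ℕ → CNF ℕ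
  | .var x, p => [[(p, false), (x, true)], [(p, true), (x, false)]]
  | .const b, p => [[(p, b)]]
  | .neg φ, p => [[(p, false), (p + 1, false)], [(p, true), (p + 1, true)]] ++ gcl φ (p + 1)
  | .conj φ ψ, p => [[(p, false), (p + 1, true)], [(p, false), (p + 1 + φ.size, true)],
      [(p, true), (p + 1, false), (p + 1 + φ.size, false)]] ++ gcl φ (p + 1) ++ gcl ψ (p + 1 + φ.size)
  | .disj φ ψ, p => [[(p, false), (p + 1, true), (p + 1 + φ.size, true)], [(p, true), (p + 1, false)],
      [(p, true), (p + 1 + φ.size, false)]] ++ gcl φ (p + 1) ++ gcl ψ (p + 1 + φ.size)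

/-- **The pre-order Tseitin CNF**: the gate clauses and the unit clause asserting the root `a`.
[cite: AroraBarakCC2009, Lemma 6.11 (proof)] -/
def cnfP (φ : PropForm ℕ) (a : ℕ) : CNF ℕ := gcl φ a ++ [[(a, true)]]

/-- At most `3 · size` gate clauses. [folklore] -/
theorem length_gcl_le (φ : PropForm ℕ) : ∀ p : ℕ, (gcl φ p).length ≤ 3 * φ.size := by
  induction φ with
  | var x => intro p; simp [gcl, PropForm.size]
  | const b => intro p; simp [gcl, PropForm.size]
  | neg φ ih => intro p; have := ih (p + 1); simp only [gcl, List.length_append, PropForm.size] at this ⊢; simp; omega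
  | conj φ ψ ih₁ ih₂ =>
    intro p; have h₁ := ih₁ (p + 1); have h₂ := ih₂ (p + 1 + φ.size)
    simp only [gcl, List.length_append, PropForm.size] at h₁ h₂ ⊢; simp; omega
  | disj φ ψ ih₁ ih₂ =>
    intro p; have h₁ := ih₁ (p + 1); have h₂ := ih₂ (p + 1 + φ.size)
    simp only [gcl, List.length_append, PropForm.size] at h₁ h₂ ⊢; simp; omega

/-- **Where the variables of the gate clauses live**: a matrix variable of `φ`, or an auxiliary in
`[p, p + size)`. [folklore] -/
theorem gcl_vars (φ : PropForm ℕ) : ∀ (p : ℕ), ∀ c ∈ gcl φ p, ∀ l ∈ c, l.1 < propFormVarBound φ ∨ (p ≤ l.1 ∧ l.1 < p + φ.size) := by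
  induction φ with
  | var x =>
    intro p c hc l hl
    have hs : (PropForm.var x).size = 1 := rfl
    have hb : propFormVarBound (.var x) = x + 1 := rfl
    simp only [gcl, List.mem_cons, List.not_mem_nil, or_false] at hc
    rcases hc with rfl | rfl
    · simp only [List.mem_cons, List.not_mem_nil, or_false] at hl
      rcases hl with rfl | rfl
      · exact Or.inr ⟨le_rfl, by omega⟩
      · exact Or.inl (by omega)
    · simp only [List.mem_cons, List.not_mem_nil, or_false] at hl
      rcases hl with rfl | rfl
      · exact Or.inr ⟨le_rfl, by omega⟩
      · exact Or.inl (by omega)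
  | const b =>
    intro p c hc l hl
    have hs : (PropForm.const b : PropForm ℕ).size = 1 := rfl
    simp only [gcl, List.mem_cons, List.not_mem_nil, or_false] at hc
    subst hc
    simp only [List.mem_cons, List.not_mem_nil, or_false] at hl
    subst hl
    exact Or.inr ⟨le_rfl, by omega⟩
  | neg φ ih =>
    intro p c hc l hl
    have hs : (PropForm.neg φ).size = φ.size + 1 := rfl
    have hb : propFormVarBound (.neg φ) = propFormVarBound φ := rfl
    have hsz := PropForm.size_pos φ
    rw [gcl, List.mem_append] at hc
    rcases hc with hc | hc
    · simp only [List.mem_cons, List.not_mem_nil, or_false] at hc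
      rcases hc with rfl | rfl <;>
      · simp only [List.mem_cons, List.not_mem_nil, or_false] at hl
        rcases hl with rfl | rfl
        · exact Or.inr ⟨le_rfl, by omega⟩
        · exact Or.inr ⟨by simp, by simp only; omega⟩
    · rcases ih (p + 1) c hc l hl with h | h
      · exact Or.inl (by omega)
      · exact Or.inr ⟨by omega, by omega⟩
  | conj φ ψ ih₁ ih₂ =>
    intro p c hc l hl
    have hs : (PropForm.conj φ ψ).size = φ.size + ψ.size + 1 := rfl
    have hb₁ : propFormVarBound φ ≤ propFormVarBound (.conj φ ψ) := le_max_left _ _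
    have hb₂ : propFormVarBound ψ ≤ propFormVarBound (.conj φ ψ) := le_max_right _ _
    have hsz := PropForm.size_pos φ; have hsz' := PropForm.size_pos ψ
    rw [gcl, List.mem_append, List.mem_append] at hc
    rcases hc with (hc | hc) | hc
    · simp only [List.mem_cons, List.not_mem_nil, or_false] at hc
      rcases hc with rfl | rfl | rfl
      · simp only [List.mem_cons, List.not_mem_nil, or_false] at hl
        rcases hl with rfl | rfl
        · exact Or.inr ⟨le_rfl, by omega⟩
        · exact Or.inr ⟨by simp only; omega, by simp only; omega⟩
      · simp only [List.mem_cons, List.not_mem_nil, or_false] at hl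
        rcases hl with rfl | rfl
        · exact Or.inr ⟨le_rfl, by omega⟩
        · exact Or.inr ⟨by simp only; omega, by simp only; omega⟩
      · simp only [List.mem_cons, List.not_mem_nil, or_false] at hl
        rcases hl with rfl | rfl | rfl
        · exact Or.inr ⟨le_rfl, by omega⟩
        · exact Or.inr ⟨by simp only; omega, by simp only; omega⟩
        · exact Or.inr ⟨by simp only; omega, by simp only; omega⟩
    · rcases ih₁ (p + 1) c hc l hl with h | h
      · exact Or.inl (by omega)
      · exact Or.inr ⟨by omega, by omega⟩
    · rcases ih₂ (p + 1 + φ.size) c hc l hl with h | h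
      · exact Or.inl (by omega)
      · exact Or.inr ⟨by omega, by omega⟩
  | disj φ ψ ih₁ ih₂ =>
    intro p c hc l hl
    have hs : (PropForm.disj φ ψ).size = φ.size + ψ.size + 1 := rfl
    have hb₁ : propFormVarBound φ ≤ propFormVarBound (.disj φ ψ) := le_max_left _ _
    have hb₂ : propFormVarBound ψ ≤ propFormVarBound (.disj φ ψ) := le_max_right _ _
    have hsz := PropForm.size_pos φ; have hsz' := PropForm.size_pos ψ
    rw [gcl, List.mem_append, List.mem_append] at hc
    rcases hc with (hc | hc) | hc
    · simp only [List.mem_cons, List.not_mem_nil, or_false] at hc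
      rcases hc with rfl | rfl | rfl
      · simp only [List.mem_cons, List.not_mem_nil, or_false] at hl
        rcases hl with rfl | rfl | rfl
        · exact Or.inr ⟨le_rfl, by omega⟩
        · exact Or.inr ⟨by simp only; omega, by simp only; omega⟩
        · exact Or.inr ⟨by simp only; omega, by simp only; omega⟩
      · simp only [List.mem_cons, List.not_mem_nil, or_false] at hl
        rcases hl with rfl | rfl
        · exact Or.inr ⟨le_rfl, by omega⟩
        · exact Or.inr ⟨by simp only; omega, by simp only; omega⟩
      · simp only [List.mem_cons, List.not_mem_nil, or_false] at hl
        rcases hl with rfl | rfl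
        · exact Or.inr ⟨le_rfl, by omega⟩
        · exact Or.inr ⟨by simp only; omega, by simp only; omega⟩
    · rcases ih₁ (p + 1) c hc l hl with h | h
      · exact Or.inl (by omega)
      · exact Or.inr ⟨by omega, by omega⟩
    · rcases ih₂ (p + 1 + φ.size) c hc l hl with h | h
      · exact Or.inl (by omega)
      · exact Or.inr ⟨by omega, by omega⟩

/-- With matrix variables `< p`, all variables of the gate clauses are `< p + size`. [folklore] -/
theorem gcl_vars_lt (φ : PropForm ℕ) (p : ℕ) (hφ : propFormVarBound φ ≤ p) : ∀ c ∈ gcl φ p, ∀ l ∈ c, l.1 < p + φ.size := by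
  intro c hc l hl
  rcases gcl_vars φ p c hc l hl with h | h
  · omega
  · exact h.2

/-! ### The intended auxiliary values -/

/-- **The intended values of the pre-order auxiliaries** over an assignment `σ` of the matrix
variables (`< p`). [cite: AroraBarakCC2009, Lemma 6.11 (proof)] -/
def val : PropForm ℕ → ℕ → (ℕ → Bool) → ℕ → Bool
  | .var x, p, σ => Function.update σ p (σ x)
  | .const b, p, σ => Function.update σ p b
  | .neg φ, p, σ => Function.update (val φ (p + 1) σ) p (!(PropForm.eval σ φ))
  | .conj φ ψ, p, σ => Function.update (val ψ (p + 1 + φ.size) (val φ (p + 1) σ)) p (PropForm.eval σ φ && PropForm.eval σ ψ)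
  | .disj φ ψ, p, σ => Function.update (val ψ (p + 1 + φ.size) (val φ (p + 1) σ)) p (PropForm.eval σ φ || PropForm.eval σ ψ)

/-- Below `p` the intended values are `σ`. [folklore] -/
theorem val_of_lt (φ : PropForm ℕ) : ∀ (p : ℕ) (σ : ℕ → Bool) {v : ℕ}, v < p → val φ p σ v = σ v := by
  induction φ with
  | var x => intro p σ v hv; simp [val, Function.update_of_ne (Nat.ne_of_lt hv)]
  | const b => intro p σ v hv; simp [val, Function.update_of_ne (Nat.ne_of_lt hv)]
  | neg φ ih => intro p σ v hv; rw [val, Function.update_of_ne (by omega), ih _ σ (by omega)]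
  | conj φ ψ ih₁ ih₂ => intro p σ v hv; rw [val, Function.update_of_ne (by omega), ih₂ _ _ (by omega), ih₁ _ σ (by omega)]
  | disj φ ψ ih₁ ih₂ => intro p σ v hv; rw [val, Function.update_of_ne (by omega), ih₂ _ _ (by omega), ih₁ _ σ (by omega)]

/-- At or above `p + size` the intended values are `σ`. [folklore] -/
theorem val_of_ge (φ : PropForm ℕ) : ∀ (p : ℕ) (σ : ℕ → Bool) {v : ℕ}, p + φ.size ≤ v → val φ p σ v = σ v := by
  induction φ with
  | var x => intro p σ v hv; simp [PropForm.size] at hv; simp [val, Function.update_of_ne (show v ≠ p by omega)]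
  | const b => intro p σ v hv; simp [PropForm.size] at hv; simp [val, Function.update_of_ne (show v ≠ p by omega)]
  | neg φ ih =>
    intro p σ v hv; simp only [PropForm.size] at hv
    rw [val, Function.update_of_ne (by omega), ih _ σ (by omega)]
  | conj φ ψ ih₁ ih₂ =>
    intro p σ v hv; simp only [PropForm.size] at hv
    rw [val, Function.update_of_ne (by omega), ih₂ _ _ (by omega), ih₁ _ σ (by omega)]
  | disj φ ψ ih₁ ih₂ =>
    intro p σ v hv; simp only [PropForm.size] at hv
    rw [val, Function.update_of_ne (by omega), ih₂ _ _ (by omega), ih₁ _ σ (by omega)]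

/-- **The intended value of the root `p` is the value of the formula.** [cite: AroraBarakCC2009, Lemma 6.11 (proof)] -/
theorem val_root (φ : PropForm ℕ) (p : ℕ) (σ : ℕ → Bool) : val φ p σ p = φ.eval σ := by
  cases φ <;> simp [val, PropForm.eval]

/-- The gate clauses of `φ` rooted at `p` only see the matrix variables and the auxiliaries
`[p, p + size)`. [folklore] -/
theorem eval_gcl_congr (φ : PropForm ℕ) (p : ℕ) {σ τ : ℕ → Bool} (h₁ : ∀ v < propFormVarBound φ, σ v = τ v)
    (h₂ : ∀ v, p ≤ v → v < p + φ.size → σ v = τ v) : (gcl φ p).eval σ = (gcl φ p).eval τ :=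
  cnf_eval_congr fun c hc l hl => by
    rcases gcl_vars φ p c hc l hl with h | h
    · exact h₁ _ h
    · exact h₂ _ h.1 h.2

/-- **The intended values satisfy the gate clauses.** [cite: AroraBarakCC2009, Lemma 6.11 (proof)] -/
theorem eval_gcl_val (φ : PropForm ℕ) : ∀ (p : ℕ) (σ : ℕ → Bool), propFormVarBound φ ≤ p → (gcl φ p).eval (val φ p σ) = true := by
  induction φ with
  | var x =>
    intro p σ hp
    simp only [propFormVarBound] at hp
    have hxp : x ≠ p := by omega
    rw [gcl]
    simp only [CNF.eval_cons, clause_eval_two, val, Function.update_self, Function.update_of_ne hxp]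
    cases σ x <;> simp [CNF.eval]
  | const b =>
    intro p σ hp
    rw [gcl]
    cases b <;> simp [CNF.eval, Literal.eval, val]
  | neg φ ih =>
    intro p σ hp
    simp only [propFormVarBound] at hp
    have e0 : val (.neg φ) p σ p = !φ.eval σ := by simp [val]
    have e1 : val (.neg φ) p σ (p + 1) = φ.eval σ := by
      rw [val, Function.update_of_ne (by omega), val_root, propForm_eval_congr (fun x hx => rfl)]
    have hsub : (gcl φ (p + 1)).eval (val (.neg φ) p σ) = true := by
      rw [val, eval_gcl_congr φ (p + 1) (τ := val φ (p + 1) σ) (fun v hv => Function.update_of_ne (by omega) _ _)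
        (fun v hv _ => Function.update_of_ne (by omega) _ _)]
      exact ih (p + 1) σ (by omega)
    rw [gcl, CNF.eval, List.all_append, Bool.and_eq_true, ← CNF.eval, ← CNF.eval]
    refine ⟨?_, hsub⟩
    simp only [CNF.eval_cons, clause_eval_two, e0, e1]
    cases φ.eval σ <;> simp [CNF.eval]
  | conj φ ψ ih₁ ih₂ =>
    intro p σ hp
    simp only [propFormVarBound, max_le_iff] at hp
    have hs := PropForm.size_pos φ
    have e0 : val (.conj φ ψ) p σ p = (φ.eval σ && ψ.eval σ) := by simp [val]
    have e1 : val (.conj φ ψ) p σ (p + 1) = φ.eval σ := by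
      rw [val, Function.update_of_ne (by omega), val_of_lt ψ _ _ (by omega), val_root]
    have e2 : val (.conj φ ψ) p σ (p + 1 + φ.size) = ψ.eval σ := by
      rw [val, Function.update_of_ne (by omega), val_root]
      exact propForm_eval_congr fun x hx => val_of_lt φ _ _ (by omega)
    have hsub₁ : (gcl φ (p + 1)).eval (val (.conj φ ψ) p σ) = true := by
      rw [val, eval_gcl_congr φ (p + 1) (τ := val φ (p + 1) σ)
        (fun v hv => by rw [Function.update_of_ne (by omega), val_of_lt ψ _ _ (by omega)])
        (fun v hv hv' => by rw [Function.update_of_ne (by omega), val_of_lt ψ _ _ (by omega)])]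
      exact ih₁ (p + 1) σ (by omega)
    have hsub₂ : (gcl ψ (p + 1 + φ.size)).eval (val (.conj φ ψ) p σ) = true := by
      rw [val, eval_gcl_congr ψ (p + 1 + φ.size) (τ := val ψ (p + 1 + φ.size) (val φ (p + 1) σ))
        (fun v hv => Function.update_of_ne (by omega) _ _) (fun v hv _ => Function.update_of_ne (by omega) _ _)]
      exact ih₂ _ _ (by omega)
    rw [gcl, CNF.eval, List.all_append, List.all_append, Bool.and_eq_true, Bool.and_eq_true, ← CNF.eval, ← CNF.eval, ← CNF.eval]
    refine ⟨⟨?_, hsub₁⟩, hsub₂⟩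
    simp only [CNF.eval_cons, clause_eval_two, clause_eval_three, e0, e1, e2]
    cases φ.eval σ <;> cases ψ.eval σ <;> simp [CNF.eval]
  | disj φ ψ ih₁ ih₂ =>
    intro p σ hp
    simp only [propFormVarBound, max_le_iff] at hp
    have hs := PropForm.size_pos φ
    have e0 : val (.disj φ ψ) p σ p = (φ.eval σ || ψ.eval σ) := by simp [val]
    have e1 : val (.disj φ ψ) p σ (p + 1) = φ.eval σ := by
      rw [val, Function.update_of_ne (by omega), val_of_lt ψ _ _ (by omega), val_root]
    have e2 : val (.disj φ ψ) p σ (p + 1 + φ.size) = ψ.eval σ := by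
      rw [val, Function.update_of_ne (by omega), val_root]
      exact propForm_eval_congr fun x hx => val_of_lt φ _ _ (by omega)
    have hsub₁ : (gcl φ (p + 1)).eval (val (.disj φ ψ) p σ) = true := by
      rw [val, eval_gcl_congr φ (p + 1) (τ := val φ (p + 1) σ)
        (fun v hv => by rw [Function.update_of_ne (by omega), val_of_lt ψ _ _ (by omega)])
        (fun v hv hv' => by rw [Function.update_of_ne (by omega), val_of_lt ψ _ _ (by omega)])]
      exact ih₁ (p + 1) σ (by omega)
    have hsub₂ : (gcl ψ (p + 1 + φ.size)).eval (val (.disj φ ψ) p σ) = true := by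
      rw [val, eval_gcl_congr ψ (p + 1 + φ.size) (τ := val ψ (p + 1 + φ.size) (val φ (p + 1) σ))
        (fun v hv => Function.update_of_ne (by omega) _ _) (fun v hv _ => Function.update_of_ne (by omega) _ _)]
      exact ih₂ _ _ (by omega)
    rw [gcl, CNF.eval, List.all_append, List.all_append, Bool.and_eq_true, Bool.and_eq_true, ← CNF.eval, ← CNF.eval, ← CNF.eval]
    refine ⟨⟨?_, hsub₁⟩, hsub₂⟩
    simp only [CNF.eval_cons, clause_eval_two, clause_eval_three, e0, e1, e2]
    cases φ.eval σ <;> cases ψ.eval σ <;> simp [CNF.eval]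

/-- **Any assignment satisfying the gate clauses gives the root the value of the formula.**
[cite: AroraBarakCC2009, Lemma 6.11 (proof)] -/
theorem root_eq_of_eval_gcl (φ : PropForm ℕ) : ∀ (p : ℕ) (τ : ℕ → Bool), (gcl φ p).eval τ = true → τ p = φ.eval τ := by
  induction φ with
  | var x =>
    intro p τ h
    rw [gcl] at h
    simp only [CNF.eval_cons, clause_eval_two, Bool.and_eq_true, Bool.or_eq_true, beq_iff_eq] at h
    obtain ⟨h1, h2, -⟩ := h
    rw [PropForm.eval]
    cases hp : τ p <;> cases hx : τ x <;> simp_all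
  | const b =>
    intro p τ h
    rw [gcl] at h
    rw [PropForm.eval]
    cases b <;> simpa [CNF.eval, Literal.eval] using h
  | neg φ ih =>
    intro p τ h
    rw [gcl, CNF.eval, List.all_append, Bool.and_eq_true, ← CNF.eval, ← CNF.eval] at h
    obtain ⟨h, hsub⟩ := h
    have hc := ih (p + 1) τ hsub
    simp only [CNF.eval_cons, clause_eval_two, Bool.and_eq_true, Bool.or_eq_true, beq_iff_eq] at h
    obtain ⟨h1, h2, -⟩ := h
    rw [PropForm.eval, ← hc]
    cases hp : τ p <;> cases hx : τ (p + 1) <;> simp_all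
  | conj φ ψ ih₁ ih₂ =>
    intro p τ h
    rw [gcl, CNF.eval, List.all_append, List.all_append, Bool.and_eq_true, Bool.and_eq_true, ← CNF.eval, ← CNF.eval, ← CNF.eval] at h
    obtain ⟨⟨h, hsub₁⟩, hsub₂⟩ := h
    have hc₁ := ih₁ (p + 1) τ hsub₁
    have hc₂ := ih₂ (p + 1 + φ.size) τ hsub₂
    simp only [CNF.eval_cons, clause_eval_two, clause_eval_three, Bool.and_eq_true, Bool.or_eq_true, beq_iff_eq] at h
    obtain ⟨h1, h2, h3, -⟩ := h
    rw [PropForm.eval, ← hc₁, ← hc₂]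
    cases hp : τ p <;> cases h1' : τ (p + 1) <;> cases h2' : τ (p + 1 + φ.size) <;> simp_all
  | disj φ ψ ih₁ ih₂ =>
    intro p τ h
    rw [gcl, CNF.eval, List.all_append, List.all_append, Bool.and_eq_true, Bool.and_eq_true, ← CNF.eval, ← CNF.eval, ← CNF.eval] at h
    obtain ⟨⟨h, hsub₁⟩, hsub₂⟩ := h
    have hc₁ := ih₁ (p + 1) τ hsub₁
    have hc₂ := ih₂ (p + 1 + φ.size) τ hsub₂
    simp only [CNF.eval_cons, clause_eval_two, clause_eval_three, Bool.and_eq_true, Bool.or_eq_true, beq_iff_eq] at h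
    obtain ⟨h1, h2, h3, -⟩ := h
    rw [PropForm.eval, ← hc₁, ← hc₂]
    cases hp : τ p <;> cases h1' : τ (p + 1) <;> cases h2' : τ (p + 1 + φ.size) <;> simp_all

/-- **Tseitin's equivalence, pre-order form**: for a matrix with variables `< a`, `φ` is true under `σ`
iff some values of the auxiliary block `a, …, a + size − 1` make the pre-order CNF true.
[cite: AroraBarakCC2009, Lemma 6.11 (proof)] -/
theorem eval_iff_exists (φ : PropForm ℕ) (a : ℕ) (ha : propFormVarBound φ ≤ a) (σ : ℕ → Bool) :
    φ.eval σ = true ↔ ∃ w : List Bool, w.length = φ.size ∧ (cnfP φ a).eval (writeVec σ a w) = true := by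
  constructor
  · intro h
    refine ⟨readVec (val φ a σ) a φ.size, by simp [readVec], ?_⟩
    rw [writeVec_readVec_eq (fun v hv => val_of_lt φ a σ hv) (fun v hv => val_of_ge φ a σ hv), cnfP,
      CNF.eval, List.all_append, Bool.and_eq_true]
    refine ⟨by rw [← CNF.eval]; exact eval_gcl_val φ a σ ha, ?_⟩
    simp [Literal.eval, val_root, h]
  · rintro ⟨w, hw, h⟩
    rw [cnfP, CNF.eval, List.all_append, Bool.and_eq_true] at h
    obtain ⟨h₁, h₂⟩ := h
    have hr := root_eq_of_eval_gcl φ a (writeVec σ a w) (by rwa [CNF.eval])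
    simp only [List.all_cons, List.all_nil, Bool.and_true, List.any_cons, List.any_nil, Bool.or_false,
      Literal.eval, beq_iff_eq] at h₂
    rw [h₂] at hr
    rw [← propForm_eval_congr (φ := φ) (σ := σ) (τ := writeVec σ a w)
      (fun x hx => (writeVec_of_lt σ a w (lt_of_lt_of_le hx ha)).symm)] at hr
    exact hr.symm

/-! ### The pre-order Tseitin form of a prenex QBF -/

/-- **The pre-order Tseitin form**: the auxiliaries of the matrix, allocated from `|qs|` in pre-order,
are quantified `∃` innermost; the matrix becomes the pre-order 3-CNF. [cite: TrevisanVadhan2007, §4 (proof of Lemma 4.1)] -/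
def preQBF (ψ : PrenexQBF) : PrenexQBF :=
  ⟨ψ.quants ++ List.replicate ψ.matrix.size false, PropForm.ofCNF (cnfP ψ.matrix ψ.quants.length)⟩

/-- The variables of the pre-order CNF of a closed formula are `< |qs| + size`. [folklore] -/
theorem cnfP_vars_lt {ψ : PrenexQBF} (h : ψ.IsClosed) :
    ∀ c ∈ cnfP ψ.matrix ψ.quants.length, ∀ l ∈ c, l.1 < ψ.quants.length + ψ.matrix.size := by
  intro c hc l hl
  rw [cnfP, List.mem_append] at hc
  rcases hc with hc | hc
  · exact gcl_vars_lt ψ.matrix _ h c hc l hl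
  · simp at hc; subst hc; simp at hl; subst hl
    have := PropForm.size_pos ψ.matrix; simp; omega

/-- **The pre-order Tseitin form of a closed prenex QBF is closed.** [folklore] -/
theorem isClosed_preQBF {ψ : PrenexQBF} (h : ψ.IsClosed) : (preQBF ψ).IsClosed := by
  rw [PrenexQBF.IsClosed, preQBF]
  simp only [List.length_append, List.length_replicate]
  exact propFormVarBound_ofCNF_le (cnfP_vars_lt h)

/-- **The pre-order Tseitin form preserves the truth of a closed prenex QBF.** [cite: TrevisanVadhan2007, §4 (proof of Lemma 4.1)] [cite: AroraBarakCC2009, Lemma 6.11] -/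
theorem isTrue_preQBF_iff {ψ : PrenexQBF} (h : ψ.IsClosed) : (preQBF ψ).IsTrue ↔ ψ.IsTrue := by
  rw [PrenexQBF.IsTrue, PrenexQBF.IsTrue, preQBF]
  symm
  refine qbfEval_congr_matrix ψ.matrix _ _ ψ.quants.length (fun σ => ?_) ψ.quants 0 (fun _ => false) (by simp)
  rw [show List.replicate ψ.matrix.size false = List.replicate ψ.matrix.size false ++ [] by rw [List.append_nil],
    qbfEval_replicate_false_append, eval_iff_exists ψ.matrix ψ.quants.length h σ]
  simp only [qbfEval, PropForm.eval_ofCNF]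

/-- **Every closed prenex QBF is an instance of Trevisan–Vadhan's universal formula through its
pre-order Tseitin form**: `ψ` is true iff `HoldsFrom (instOf (QBFUniv.sizeOf ψ) (qs ++ ∃^{size}) (cnfP matrix |qs|)) 0`.
[cite: TrevisanVadhan2007, Lemma 4.1 (ii)] -/
theorem isTrue_iff_holdsFrom_pre {ψ : PrenexQBF} (h : ψ.IsClosed) :
    ψ.IsTrue ↔ HoldsFrom (instOf (QBFUniv.sizeOf ψ) (preQBF ψ).quants (cnfP ψ.matrix ψ.quants.length)) 0 := by
  rw [← isTrue_preQBF_iff h]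
  have hs := PropForm.size_pos ψ.matrix
  refine isTrue_iff_holdsFrom_instOf (by rw [QBFUniv.sizeOf]; omega) (by simp [QBFUniv.sizeOf]) ?_ ?_
  · rw [cnfP, List.length_append, List.length_singleton, QBFUniv.sizeOf]
    have := length_gcl_le ψ.matrix ψ.quants.length
    omega
  · intro c hc l hl
    simp only [List.length_append, List.length_replicate]
    exact cnfP_vars_lt h c hc l hl

end PreTseitin

end Literature.Computability.Complexity
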